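import Summits.CriticalPhenomena.PercolationContinuityZ3.Theorems.PercNearOneGluingNoHeavyRsw3InvasionOutletDensity
import Literature.Analysis.Complex.SlitHalfStripDensityBounds
import HarnessLib

/-!
# RSW3 lane (P2, gen 28): INVASION PERCOLATION XXVII — THE OUTLET RATE NEAR `p_c`: an explicit lower bound in terms of the susceptibility,
# `liminf M_n(y)/n ≥ (p_c − y) / (8 χ(ȳ)·(4 + 2 log χ(ȳ) + log(1/(p_c − y))))`, `ȳ = (y + p_c)/2`

builds on p205010 (kernel theorem, internal audit signed; external expert review pending) — NOT used in this file.

Cell `prim-rsw3`, prover seat `prim-rsw3-p2` (gen 28), memo `run/shared/lean/prim/rsw3/P2-RSWLITE.md` §35.  Support file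
(`--supports stmt-CriticalPhenomena-4575`); no definitions, no named facts, no sorries.  `M_n(y)` = number of outlets at level `y` before time `n`,
`χ(p) = chi d p` the susceptibility (finite below `p_c` by sharpness).

Files XXIV–XXV give a positive outlet rate `ρ(y) := liminf M_n(y)/n ≥ c(y) > 0` for `y < p_c(ℤ^d)` with an unspecified constant.  This file tracks the
constants: the tail `μ{M_N(y) ≤ k} ≤ Φ^{k+1} e^{−λ(N+1)/2}` holds with `Φ = 1 + A/(1 − e^{−λ/2})` whenever `μ{m ≤ |C_y(v)|} ≤ A e^{−λm}`, Borel–Cantelli gives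
the rate `c = λ/(4(log Φ + 1))`, and on `ℤ^d` Hutchcroft's integrated inequality between `y` and `ȳ = (y + p_c)/2` gives `A = χ(ȳ) e^{p_c − y}`,
`λ = (1 − e^{−1})(p_c − y)/χ(ȳ)`.  Elementary bounds (`1 − e^{−x} ≥ x/(1+x)`, `log(1 + 6e) ≤ 3`) then yield

* **`ae_eventually_mul_le_badCount_chi`** — for `d ≥ 2`, `0 < y < p_c(ℤ^d)`: almost surely, for all large `n`,
  `M_n(y) ≥ n · (p_c − y) / (8 χ(ȳ) (4 + 2 log χ(ȳ) + log(1/(p_c − y))))`.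
Together with file XXV's `M_n(y) ≤ ((2d−1)(p_c − y) + ε) n`: THE OUTLET RATE VANISHES AT `p_c` LINEARLY FROM ABOVE AND AT LEAST LIKE `(p_c − y)/(χ log)`
FROM BELOW — if `χ(p) ≍ (p_c − p)^{−γ}` and `ρ(y) ≍ (p_c − y)^{β}` then `1 ≤ β ≤ 1 + γ` (up to the logarithm).

* `labelMeasure_real_badCount_le_of_exp_volume_tail_explicit`, `ae_eventually_mul_le_badCount_of_exp_volume_tail_explicit` (every graph, explicit
  `Φ`, `c`); `labelMeasure_real_le_encard_le_chi_mul_exp` (`ℤ^d`: the explicit subcritical tail at every vertex);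
  `ae_eventually_mul_le_badCount_explicit` (`ℤ^d`, the raw explicit rate).

References: J. T. Chayes, L. Chayes, C. M. Newman, Comm. Math. Phys. 101 (1985) 383–407, Lemma 3.4, Thm 3.3, §6 (rates) [ChayesChayesNewman1985];
T. Hutchcroft, Probab. Math. Phys. 1 (2020), §4.1 [Hutchcroft2020].
-/

noncomputable section

namespace Summit.CriticalPhenomena.PercolationContinuityZ3.Theorems.Rsw3

open Finset MeasureTheory Filter Topology Literature.Probability.Percolation Literature.Probability.Percolation.Invasion
open scoped ENNReal

/-! ## §0 An elementary inequality (`x/(1+x) ≤ 1 − e^{−x}` is the tree's `Literature.Analysis.Complex.div_one_add_le_one_sub_exp_neg`) -/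

/-- `log(1 + 6e) ≤ 3`. [folklore] -/
theorem log_one_add_six_mul_exp_one_le : Real.log (1 + 6 * Real.exp 1) ≤ 3 := by
  have he : Real.exp 1 < 2.7182818286 := Real.exp_one_lt_d9
  have h : 1 + 6 * Real.exp 1 ≤ Real.exp 3 := by
    have : (2.7 : ℝ) ^ 3 ≤ Real.exp 3 := by
      have := Real.exp_one_gt_d9
      calc (2.7 : ℝ) ^ 3 ≤ (Real.exp 1) ^ 3 := by gcongr; linarith
        _ = Real.exp 3 := by rw [← Real.exp_nat_mul]; norm_num
    nlinarith
  calc Real.log (1 + 6 * Real.exp 1) ≤ Real.log (Real.exp 3) := Real.log_le_log (by positivity) h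
    _ = 3 := Real.log_exp 3

/-! ## §1 Explicit constants on every graph -/

section General

variable {V : Type*} [DecidableEq V] {G : SimpleGraph V} [G.LocallyFinite] [Countable V] [Infinite V]

/-- **Explicit tail bound** (every infinite connected locally finite graph): if `μ{m ≤ |C_y(v)|} ≤ A e^{−λm}` (`A ≥ 0`, `λ > 0`, all `v`, `m ≥ 1`) then
`μ{M_N(y) ≤ k} ≤ (1 + A/(1 − e^{−λ/2}))^{k+1} · e^{−(λ/2)(N+1)}` (file XXIII with `q_m = A e^{−λm}`, `t = λ/2`).
[cite: ChayesChayesNewman1985, Lemma 3.4 and Thm 3.3] -/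
theorem labelMeasure_real_badCount_le_of_exp_volume_tail_explicit (hG : G.Preconnected) (o : V) (y : ℝ) {A lam : ℝ} (hA : 0 ≤ A)
    (hlam : 0 < lam)
    (htail : ∀ (v : V) (m : ℕ), 1 ≤ m →
      (labelMeasure V).real {U : Sym2 V → ℝ | (m : ℕ∞) ≤ (openCluster (configOfLabels y U G) v).encard} ≤ A * Real.exp (-(lam * m)))
    (N k : ℕ) :
    (labelMeasure V).real {U | badCount G U o y N ≤ k}
      ≤ (1 + A / (1 - Real.exp (-(lam / 2)))) ^ (k + 1) * Real.exp (-(lam / 2 * (N + 1))) := by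
  set r : ℝ := Real.exp (-(lam / 2)) with hr
  have hr0 : 0 < r := Real.exp_pos _
  have hr1 : r < 1 := Real.exp_lt_one_iff.2 (by linarith)
  have hsumr : Summable fun m : ℕ => r ^ m := summable_geometric_of_lt_one hr0.le hr1
  have htsum : ∑' m : ℕ, r ^ m = (1 - r)⁻¹ := tsum_geometric_of_lt_one hr0.le hr1
  set Φ : ℝ := 1 + A / (1 - r) with hΦ
  have hΦ1 : 1 ≤ Φ := by
    have : 0 ≤ A / (1 - r) := div_nonneg hA (by linarith)
    linarith
  have hΦL : 1 + ∑ m ∈ Icc 1 (N + 1), (Real.exp (lam / 2 * m) - Real.exp (lam / 2 * (m - 1))) * (A * Real.exp (-(lam * m))) ≤ Φ := by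
    have hterm : ∀ m ∈ Icc 1 (N + 1),
        (Real.exp (lam / 2 * m) - Real.exp (lam / 2 * (m - 1))) * (A * Real.exp (-(lam * m))) ≤ A * r ^ m := by
      intro m _
      have hsub : Real.exp (lam / 2 * m) - Real.exp (lam / 2 * (m - 1)) ≤ Real.exp (lam / 2 * m) := by
        linarith [Real.exp_nonneg (lam / 2 * (m - 1))]
      have hrm : Real.exp (lam / 2 * m) * Real.exp (-(lam * m)) = r ^ m := by
        rw [hr, ← Real.exp_nat_mul, ← Real.exp_add]; congr 1; ring
      calc (Real.exp (lam / 2 * m) - Real.exp (lam / 2 * (m - 1))) * (A * Real.exp (-(lam * m)))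
          ≤ Real.exp (lam / 2 * m) * (A * Real.exp (-(lam * m))) :=
            mul_le_mul_of_nonneg_right hsub (mul_nonneg hA (Real.exp_nonneg _))
        _ = A * r ^ m := by rw [← hrm]; ring
    calc 1 + ∑ m ∈ Icc 1 (N + 1), (Real.exp (lam / 2 * m) - Real.exp (lam / 2 * (m - 1))) * (A * Real.exp (-(lam * m)))
        ≤ 1 + ∑ m ∈ Icc 1 (N + 1), A * r ^ m := by have := Finset.sum_le_sum hterm; linarith
      _ = 1 + A * ∑ m ∈ Icc 1 (N + 1), r ^ m := by rw [Finset.mul_sum]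
      _ ≤ 1 + A * (1 - r)⁻¹ := by
        gcongr
        rw [← htsum]
        exact Summable.sum_le_tsum _ (fun m _ => pow_nonneg hr0.le m) hsumr
      _ = Φ := by rw [hΦ, div_eq_mul_inv]
  exact labelMeasure_real_badCount_le_le hG o y (le_of_lt (half_pos hlam)) N (fun m => A * Real.exp (-(lam * m)))
    (fun v m hm _ => htail v m hm) hΦ1 hΦL k

/-- **Explicit outlet rate** (every infinite connected locally finite graph): under `μ{m ≤ |C_y(v)|} ≤ A e^{−λm}`, almost surely
`c·n ≤ M_n(y)` for all large `n` with **`c = λ / (4 (log(1 + A/(1 − e^{−λ/2})) + 1))`** (file XXIV's Borel–Cantelli with the constants kept).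
[cite: ChayesChayesNewman1985, Thm 3.3 (C bounded away from 0) and Lemma 3.4] -/
theorem ae_eventually_mul_le_badCount_of_exp_volume_tail_explicit (hG : G.Preconnected) (o : V) (y : ℝ) {A lam : ℝ} (hA : 0 ≤ A)
    (hlam : 0 < lam)
    (htail : ∀ (v : V) (m : ℕ), 1 ≤ m →
      (labelMeasure V).real {U : Sym2 V → ℝ | (m : ℕ∞) ≤ (openCluster (configOfLabels y U G) v).encard} ≤ A * Real.exp (-(lam * m))) :
    ∀ᵐ U ∂(labelMeasure V), ∀ᶠ n : ℕ in atTop,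
      lam / (4 * (Real.log (1 + A / (1 - Real.exp (-(lam / 2)))) + 1)) * n ≤ badCount G U o y n := by
  haveI : IsProbabilityMeasure (labelMeasure V) := isProbabilityMeasure_labelMeasure _
  set Φ : ℝ := 1 + A / (1 - Real.exp (-(lam / 2))) with hΦ
  have hr1 : Real.exp (-(lam / 2)) < 1 := Real.exp_lt_one_iff.2 (by linarith)
  have hΦ1 : 1 ≤ Φ := by
    have : 0 ≤ A / (1 - Real.exp (-(lam / 2))) := div_nonneg hA (by linarith)
    linarith
  have hΦ0 : 0 < Φ := by linarith
  have hlog : 0 ≤ Real.log Φ := Real.log_nonneg hΦ1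
  set s : ℝ := lam / 2 with hs
  have hs0 : 0 < s := half_pos hlam
  set c : ℝ := s / (2 * (Real.log Φ + 1)) with hc
  have hc_eq : lam / (4 * (Real.log Φ + 1)) = c := by
    rw [hc, hs, div_div]; congr 1; ring
  rw [hc_eq]
  have hclog : c * Real.log Φ ≤ s / 2 := by
    rw [hc, div_mul_eq_mul_div, div_le_div_iff₀ (by positivity) (by norm_num)]
    nlinarith
  have hbnd : ∀ N k : ℕ, (labelMeasure V).real {U | badCount G U o y N ≤ k} ≤ Φ ^ (k + 1) * Real.exp (-(s * (N + 1))) :=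
    fun N k => labelMeasure_real_badCount_le_of_exp_volume_tail_explicit hG o y hA hlam htail N k
  -- Borel–Cantelli, as in file XXIV
  set Bad : ℕ → Set (Sym2 V → ℝ) := fun N => {U | badCount G U o y N ≤ ⌊c * N⌋₊} with hBad
  have hbound : ∀ N : ℕ, labelMeasure V (Bad N) ≤ ENNReal.ofReal (Φ * Real.exp (-(s / 2)) ^ N) := by
    intro N
    rw [← ofReal_measureReal (measure_ne_top _ _)]
    refine ENNReal.ofReal_le_ofReal ((hbnd N ⌊c * N⌋₊).trans ?_)
    have hk : (⌊c * N⌋₊ : ℝ) ≤ c * N := Nat.floor_le (by positivity)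
    have hpow : Φ ^ (⌊c * N⌋₊ + 1) ≤ Φ * Real.exp (s / 2 * N) := by
      rw [pow_succ', ← Real.exp_log hΦ0, ← Real.exp_nat_mul, Real.exp_log hΦ0]
      refine mul_le_mul_of_nonneg_left (Real.exp_le_exp.2 ?_) hΦ0.le
      calc (⌊c * N⌋₊ : ℝ) * Real.log Φ ≤ c * N * Real.log Φ := mul_le_mul_of_nonneg_right hk hlog
        _ = (c * Real.log Φ) * N := by ring
        _ ≤ s / 2 * N := mul_le_mul_of_nonneg_right hclog (Nat.cast_nonneg N)
    calc Φ ^ (⌊c * N⌋₊ + 1) * Real.exp (-(s * (N + 1)))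
        ≤ Φ * Real.exp (s / 2 * N) * Real.exp (-(s * (N + 1))) := mul_le_mul_of_nonneg_right hpow (Real.exp_nonneg _)
      _ = Φ * Real.exp (-(s / 2) * N) * Real.exp (-s) := by rw [mul_assoc, mul_assoc, ← Real.exp_add, ← Real.exp_add]; congr 2; ring
      _ ≤ Φ * Real.exp (-(s / 2) * N) * 1 :=
          mul_le_mul_of_nonneg_left (Real.exp_le_one_iff.2 (by linarith)) (by positivity)
      _ = Φ * Real.exp (-(s / 2)) ^ N := by rw [mul_one, ← Real.exp_nat_mul]; ring_nf
  have hsum : ∑' N, labelMeasure V (Bad N) ≠ ∞ := by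
    have hgeo : Summable fun N : ℕ => Φ * Real.exp (-(s / 2)) ^ N :=
      (summable_geometric_of_lt_one (Real.exp_nonneg _) (Real.exp_lt_one_iff.2 (by linarith))).mul_left Φ
    refine ne_top_of_le_ne_top ?_ (ENNReal.tsum_le_tsum hbound)
    rw [← ENNReal.ofReal_tsum_of_nonneg (fun N => by positivity) hgeo]
    exact ENNReal.ofReal_ne_top
  filter_upwards [ae_eventually_notMem hsum] with U hU
  filter_upwards [hU] with N hN
  simp only [hBad, Set.mem_setOf_eq, not_le] at hN
  have h1 : c * N < (badCount G U o y N : ℝ) := by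
    calc c * N < (⌊c * N⌋₊ : ℝ) + 1 := Nat.lt_floor_add_one _
      _ ≤ badCount G U o y N := by exact_mod_cast hN
  exact h1.le

end General

/-! ## §2 `ℤ^d`: the explicit subcritical tail and the explicit rate -/

section Zd

open Literature.Probability.LatticeModels

variable {d : ℕ}

/-- **The explicit subcritical volume tail at every vertex** (`d ≥ 2`, `0 < y < p_c(ℤ^d)`, `ȳ = (y + p_c)/2`):
`μ{m ≤ |C_y(v)|} ≤ χ(ȳ) e^{p_c − y} · exp(−(1 − e^{−1})(p_c − y) m/χ(ȳ))` for all `v` and `m ≥ 1` (Hutchcroft's (integrated2) between `y` and `ȳ`;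
translation invariance). [cite: Hutchcroft2020, §4.1 (integrated2)] -/
theorem labelMeasure_real_le_encard_le_chi_mul_exp (hd : 2 ≤ d) {y : ℝ} (hy0 : 0 < y) (hy : y < criticalProb (zdGraph d) (0 : Site d))
    (v : Site d) {m : ℕ} (hm : 1 ≤ m) :
    (labelMeasure (Site d)).real {U : Sym2 (Site d) → ℝ | (m : ℕ∞) ≤ (openCluster (configOfLabels y U (zdGraph d)) v).encard}
      ≤ chi d (Set.projIcc 0 1 zero_le_one ((y + criticalProb (zdGraph d) (0 : Site d)) / 2))
          * Real.exp (criticalProb (zdGraph d) (0 : Site d) - y)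
          * Real.exp (-((1 - Real.exp (-1)) * (criticalProb (zdGraph d) (0 : Site d) - y)
              / chi d (Set.projIcc 0 1 zero_le_one ((y + criticalProb (zdGraph d) (0 : Site d)) / 2)) * m)) := by
  set pc : ℝ := criticalProb (zdGraph d) (0 : Site d) with hpc
  have hy1 : y ≤ 1 := hy.le.trans (criticalProb_zd_lt_one hd).le
  set yI : unitInterval := ⟨y, hy0.le, hy1⟩ with hyI
  have hyc : y < criticalProbI d := by rw [coe_criticalProbI]; exact hy
  set t : ℝ := (y + pc) / 2 with ht
  have hpcI : pc = criticalProbI d := by rw [hpc, coe_criticalProbI]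
  have hyt : y < t := by rw [ht]; linarith
  have htc : t < criticalProbI d := by rw [ht, hpcI]; linarith
  have ht1 : t ≤ 1 := htc.le.trans (criticalProbI d).2.2
  set tI : unitInterval := Set.projIcc 0 1 zero_le_one t with htI
  have htt : (tI : ℝ) = t := by rw [htI, Set.projIcc_of_mem _ ⟨(hy0.trans hyt).le, ht1⟩]
  have hχ1 : 1 ≤ chi d tI := one_le_chi hd tI (by rw [htt, ← coe_criticalProbI]; exact htc)
  have hχ0 : 0 < chi d tI := by linarith
  -- reduce to the origin and to the bond-percolation law
  have h1 : (labelMeasure (Site d)).real {U : Sym2 (Site d) → ℝ |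
      (m : ℕ∞) ≤ (openCluster (configOfLabels y U (zdGraph d)) v).encard}
      = (bondPercolation (zdGraph d) yI).real (clusterSizeGe v m) := by
    rw [measureReal_def, measureReal_def, ← labelMeasure_setOf_le_encard_openCluster yI v m]
  rw [h1, Literature.Barriers.CriticalPhenomena.real_clusterSizeGe_eq_zero]
  have h := HutchcroftMoments.real_clusterSizeGe_le_chi_mul_exp (d := d) hd hm hy0 hyt htc
  rw [Set.projIcc_val zero_le_one yI] at h
  refine h.trans ?_
  have hn0 : (1 : ℝ) ≤ m := by exact_mod_cast hm
  have hdiv : chi d tI / m ≤ chi d tI := div_le_self hχ0.le hn0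
  have h2ty : 2 * (t - y) = pc - y := by rw [ht]; ring
  have hexp : Real.exp (-((t - y) * (2 * (1 - Real.exp (-1)) * m / chi d tI - 2)))
      = Real.exp (pc - y) * Real.exp (-((1 - Real.exp (-1)) * (pc - y) / chi d tI * m)) := by
    rw [← Real.exp_add]; congr 1
    rw [← h2ty]; field_simp; ring
  rw [hexp, ← mul_assoc]
  exact mul_le_mul_of_nonneg_right (mul_le_mul_of_nonneg_right hdiv (Real.exp_nonneg _)) (Real.exp_nonneg _)

/-- **The raw explicit rate on `ℤ^d`** (`d ≥ 2`, `0 < y < p_c`): almost surely `c(y)·n ≤ M_n(y)` for all large `n`, with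
`c(y) = λ/(4(log(1 + A/(1 − e^{−λ/2})) + 1))`, `A = χ(ȳ)e^{p_c − y}`, `λ = (1 − e^{−1})(p_c − y)/χ(ȳ)`, `ȳ = (y + p_c)/2`.
[cite: ChayesChayesNewman1985, Thm 3.3 and Lemma 3.4] [cite: Hutchcroft2020, §4.1] -/
theorem ae_eventually_mul_le_badCount_explicit (hd : 2 ≤ d) {y : ℝ} (hy0 : 0 < y) (hy : y < criticalProb (zdGraph d) (0 : Site d)) :
    ∀ᵐ U ∂(labelMeasure (Site d)), ∀ᶠ n : ℕ in atTop,
      ((1 - Real.exp (-1)) * (criticalProb (zdGraph d) (0 : Site d) - y)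
          / chi d (Set.projIcc 0 1 zero_le_one ((y + criticalProb (zdGraph d) (0 : Site d)) / 2)))
        / (4 * (Real.log (1 + chi d (Set.projIcc 0 1 zero_le_one ((y + criticalProb (zdGraph d) (0 : Site d)) / 2))
              * Real.exp (criticalProb (zdGraph d) (0 : Site d) - y)
              / (1 - Real.exp (-(((1 - Real.exp (-1)) * (criticalProb (zdGraph d) (0 : Site d) - y)
                  / chi d (Set.projIcc 0 1 zero_le_one ((y + criticalProb (zdGraph d) (0 : Site d)) / 2))) / 2)))) + 1))
        * n ≤ badCount (zdGraph d) U 0 y n := by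
  haveI : Nonempty (Fin d) := ⟨⟨0, by omega⟩⟩
  haveI : Infinite (Site d) := Pi.infinite_of_right
  set tI : unitInterval := Set.projIcc 0 1 zero_le_one ((y + criticalProb (zdGraph d) (0 : Site d)) / 2) with htI
  have hyc : y < criticalProbI d := by rw [coe_criticalProbI]; exact hy
  have htc : (y + criticalProb (zdGraph d) (0 : Site d)) / 2 < criticalProbI d := by rw [← coe_criticalProbI]; linarith
  have ht1 : (y + criticalProb (zdGraph d) (0 : Site d)) / 2 ≤ 1 := htc.le.trans (criticalProbI d).2.2
  have htt : (tI : ℝ) = (y + criticalProb (zdGraph d) (0 : Site d)) / 2 := by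
    rw [htI, Set.projIcc_of_mem _ ⟨by linarith, ht1⟩]
  have hχ1 : 1 ≤ chi d tI := one_le_chi hd tI (by rw [htt]; linarith)
  have hA : 0 ≤ chi d tI * Real.exp (criticalProb (zdGraph d) (0 : Site d) - y) := by positivity
  have h1e : 0 < 1 - Real.exp (-1) := by linarith [Real.exp_lt_one_iff.2 (show (-1 : ℝ) < 0 by norm_num)]
  have hlam : 0 < (1 - Real.exp (-1)) * (criticalProb (zdGraph d) (0 : Site d) - y) / chi d tI := by
    have : 0 < criticalProb (zdGraph d) (0 : Site d) - y := by linarith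
    positivity
  exact ae_eventually_mul_le_badCount_of_exp_volume_tail_explicit zdGraph_preconnected_holds (0 : Site d) y hA hlam
    (fun v m hm => labelMeasure_real_le_encard_le_chi_mul_exp hd hy0 hy v hm)

/-- **THE OUTLET RATE NEAR `p_c` IN TERMS OF THE SUSCEPTIBILITY**: for `d ≥ 2` and `0 < y < p_c(ℤ^d)`, with `ȳ = (y + p_c)/2`, almost surely,
for all large `n`,
  **`M_n(y) ≥ n · (p_c − y) / (8 χ(ȳ) · (4 + 2 log χ(ȳ) + log(1/(p_c − y))))`.**
With file XXV (`M_n(y) ≤ ((2d−1)(p_c − y) + ε) n` eventually) this brackets the outlet rate near `p_c` between `(p_c − y)/(χ log)` and `(p_c − y)`: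
an outlet-rate exponent `β`, if `χ ≍ (p_c − p)^{−γ}`, satisfies `1 ≤ β ≤ 1 + γ`.
[cite: ChayesChayesNewman1985, Thm 3.3, Lemma 3.4 and §6] [cite: Hutchcroft2020, §4.1] -/
theorem ae_eventually_mul_le_badCount_chi (hd : 2 ≤ d) {y : ℝ} (hy0 : 0 < y) (hy : y < criticalProb (zdGraph d) (0 : Site d)) :
    ∀ᵐ U ∂(labelMeasure (Site d)), ∀ᶠ n : ℕ in atTop,
      (criticalProb (zdGraph d) (0 : Site d) - y)
          / (8 * chi d (Set.projIcc 0 1 zero_le_one ((y + criticalProb (zdGraph d) (0 : Site d)) / 2))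
              * (4 + 2 * Real.log (chi d (Set.projIcc 0 1 zero_le_one ((y + criticalProb (zdGraph d) (0 : Site d)) / 2)))
                  + Real.log (1 / (criticalProb (zdGraph d) (0 : Site d) - y))))
        * n ≤ badCount (zdGraph d) U 0 y n := by
  set pc : ℝ := criticalProb (zdGraph d) (0 : Site d) with hpc
  set tI : unitInterval := Set.projIcc 0 1 zero_le_one ((y + pc) / 2) with htI
  set χ : ℝ := chi d tI with hχ
  set δ : ℝ := pc - y with hδ
  have hδ0 : 0 < δ := by rw [hδ]; linarith
  have hδ1 : δ ≤ 1 := by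
    have := (criticalProb_zd_lt_one hd).le; rw [hδ]; linarith
  have hyc : y < criticalProbI d := by rw [coe_criticalProbI]; exact hy
  have htc : (y + pc) / 2 < criticalProbI d := by rw [hpc, ← coe_criticalProbI]; linarith
  have ht1 : (y + pc) / 2 ≤ 1 := htc.le.trans (criticalProbI d).2.2
  have htt : (tI : ℝ) = (y + pc) / 2 := by rw [htI, Set.projIcc_of_mem _ ⟨by linarith, ht1⟩]
  have hχ1 : 1 ≤ χ := one_le_chi hd tI (by rw [htt, hpc]; linarith)
  have hχ0 : 0 < χ := by linarith
  -- the constants of the raw rate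
  set lam : ℝ := (1 - Real.exp (-1)) * δ / χ with hlam
  set A : ℝ := χ * Real.exp δ with hA
  set Φ : ℝ := 1 + A / (1 - Real.exp (-(lam / 2))) with hΦ
  have he1 : Real.exp (-1) ≤ 1 / 2 := by
    have h := Real.exp_one_gt_d9
    rw [Real.exp_neg, inv_le_comm₀ (Real.exp_pos 1) (by norm_num)]
    linarith
  have h1e : 1 / 2 ≤ 1 - Real.exp (-1) := by linarith
  have h1e' : 1 - Real.exp (-1) ≤ 1 := by linarith [Real.exp_nonneg (-1)]
  have hlam0 : 0 < lam := by rw [hlam]; positivity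
  have hlam_ge : δ / (2 * χ) ≤ lam := by
    rw [hlam, div_le_div_iff₀ (by positivity) hχ0]
    have hprod : 0 < δ * χ := mul_pos hδ0 hχ0
    nlinarith [hprod, h1e]
  have hlam_le : lam ≤ 1 := by
    rw [hlam, div_le_one hχ0]
    nlinarith
  -- `1 − e^{−λ/2} ≥ λ/3`
  have hden : lam / 3 ≤ 1 - Real.exp (-(lam / 2)) := by
    have h := Literature.Analysis.Complex.div_one_add_le_one_sub_exp_neg (y := lam / 2) (by positivity)
    refine le_trans ?_ h
    rw [div_le_div_iff₀ (by norm_num) (by positivity)]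
    nlinarith
  have hden0 : 0 < 1 - Real.exp (-(lam / 2)) := lt_of_lt_of_le (by positivity) hden
  -- `A ≤ e χ`, `Φ ≤ (1 + 6e) χ²/δ`
  have hAle : A ≤ Real.exp 1 * χ := by
    rw [hA, mul_comm]; exact mul_le_mul_of_nonneg_right (Real.exp_le_exp.2 hδ1) hχ0.le
  have hΦle : Φ ≤ (1 + 6 * Real.exp 1) * (χ ^ 2 / δ) := by
    have h1 : A / (1 - Real.exp (-(lam / 2))) ≤ Real.exp 1 * χ / (lam / 3) :=
      div_le_div₀ (by positivity) hAle (by positivity) hden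
    have h2 : Real.exp 1 * χ / (lam / 3) ≤ Real.exp 1 * χ / (δ / (2 * χ) / 3) :=
      div_le_div_of_nonneg_left (by positivity) (by positivity) (by linarith)
    have h3 : Real.exp 1 * χ / (δ / (2 * χ) / 3) = 6 * Real.exp 1 * (χ ^ 2 / δ) := by
      field_simp; ring
    have h4 : 1 ≤ χ ^ 2 / δ := by
      rw [le_div_iff₀ hδ0]; nlinarith
    calc Φ = 1 + A / (1 - Real.exp (-(lam / 2))) := rfl
      _ ≤ 1 + 6 * Real.exp 1 * (χ ^ 2 / δ) := by linarith
      _ ≤ (χ ^ 2 / δ) + 6 * Real.exp 1 * (χ ^ 2 / δ) := by linarith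
      _ = (1 + 6 * Real.exp 1) * (χ ^ 2 / δ) := by ring
  have hΦ1 : 1 ≤ Φ := by
    have : 0 ≤ A / (1 - Real.exp (-(lam / 2))) := div_nonneg (by positivity) hden0.le
    rw [hΦ]; linarith
  -- `log Φ + 1 ≤ 4 + 2 log χ + log(1/δ)`
  have hlogΦ : Real.log Φ + 1 ≤ 4 + 2 * Real.log χ + Real.log (1 / δ) := by
    have h1 : Real.log Φ ≤ Real.log ((1 + 6 * Real.exp 1) * (χ ^ 2 / δ)) := Real.log_le_log (by linarith) hΦle
    have h2 : Real.log ((1 + 6 * Real.exp 1) * (χ ^ 2 / δ))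
        = Real.log (1 + 6 * Real.exp 1) + (2 * Real.log χ + Real.log (1 / δ)) := by
      rw [Real.log_mul (by positivity) (by positivity), Real.log_div (by positivity) hδ0.ne', Real.log_pow, one_div,
        Real.log_inv]
      push_cast; ring
    linarith [log_one_add_six_mul_exp_one_le]
  have hD0 : 0 < 4 + 2 * Real.log χ + Real.log (1 / δ) := by
    have : 0 ≤ Real.log χ := Real.log_nonneg hχ1
    have : 0 ≤ Real.log (1 / δ) := Real.log_nonneg (by rw [le_div_iff₀ hδ0]; linarith)
    linarith
  -- compare the clean constant with the raw one
  have hcmp : δ / (8 * χ * (4 + 2 * Real.log χ + Real.log (1 / δ))) ≤ lam / (4 * (Real.log Φ + 1)) := by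
    have hlog1 : 0 < Real.log Φ + 1 := by linarith [Real.log_nonneg hΦ1]
    calc δ / (8 * χ * (4 + 2 * Real.log χ + Real.log (1 / δ)))
        = (δ / (2 * χ)) / (4 * (4 + 2 * Real.log χ + Real.log (1 / δ))) := by field_simp; ring
      _ ≤ lam / (4 * (4 + 2 * Real.log χ + Real.log (1 / δ))) := div_le_div_of_nonneg_right hlam_ge (by positivity)
      _ ≤ lam / (4 * (Real.log Φ + 1)) := div_le_div_of_nonneg_left hlam0.le (by positivity) (by linarith)
  have hraw := ae_eventually_mul_le_badCount_explicit hd hy0 hy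
  filter_upwards [hraw] with U hU
  filter_upwards [hU] with n hn
  exact le_trans (mul_le_mul_of_nonneg_right hcmp (Nat.cast_nonneg n)) hn

end Zd

end Summit.CriticalPhenomena.PercolationContinuityZ3.Theorems.Rsw3

end
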